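/-
Copyright: rh-split cell (screw, bridge) gen 14, 2026-08-27.  Splitting search over kernel-typed
RH-equivalences.  A splitting `A ∧ B ⟹ RH` is CONDITIONAL bookkeeping unless `A` and `B` are both
proved; nothing here bears on the truth of RH.
-/
import Summits.RiemannHypothesis.RiemannHypothesis.Theorems.Splittings.ScrewLatticeContinuationA
import HarnessLib

/-!
# Row X-9 — part B: corollaries (`FOZ ∧ CEIL(h)`, `LPSD(h) ∧ CC(h)`), row `ES ∧ CEIL(h) ⟺ RH`, and the
RH-free WALLS theorem

Continuation of `ScrewLatticeContinuationA` (same namespace `…Splittings.ScrewLatticeContinuation`, whose module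
docstring states the objects `LatticeCeiling`, `CountableClosure`, `aliasedPoleSet`, `latticeGF` and row X-9).
No `sorry`, no new axioms, no instances, no notation.
-/

set_option linter.dupNamespace false

namespace Summit.RiemannHypothesis.RiemannHypothesis.Theorems.Splittings.ScrewLatticeContinuation

open Complex Filter Topology Set Metric
open Literature.NumberTheory.LFunctions
open ZetaZeros.riemannZetaNontrivialZeros
open Summit.RiemannHypothesis.RiemannHypothesis.Theorems.Splittings
open Summit.RiemannHypothesis.RiemannHypothesis.Theorems.Splittings.ScrewBorel

/-! ## 5. Corollaries: `FOZ ∧ CEIL(h)`, `LPSD(h) ∧ CC(h)` -/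

/-- Finitely many zeros off the line ⟹ the aliased pole field is finite ⟹ `CC(h)`. -/
theorem countableClosure_of_foz (hfoz : Theses.RuelleBand.CofiniteCriticalLine) (h : ℝ) :
    CountableClosure h := by
  set OFF : Set ℂ := {s : ℂ | riemannZeta s = 0 ∧ 0 < s.re ∧ s.re < 1 ∧ s.re ≠ 1 / 2} with hOFF
  have hfin : OFF.Finite := hfoz
  set g₁ : ℂ → ℂ := fun s ↦ Complex.exp ((s - 1 / 2) * h) with hg₁
  set g₂ : ℂ → ℂ := fun s ↦ (Complex.exp ((s - 1 / 2) * h))⁻¹ with hg₂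
  have hsub : aliasedPoleSet h ⊆ g₁ '' OFF ∪ g₂ '' OFF := by
    rintro p ⟨hp1, ρ, hp⟩
    have hoff : (ρ : ℂ) ∈ OFF := by
      refine ⟨zeta_eq_zero ρ.2, re_pos ρ.2, re_lt_one ρ.2, fun hre ↦ ?_⟩
      have hn : ‖mult h ρ‖ = 1 := by rw [norm_mult, hre, sub_self, zero_mul, Real.exp_zero]
      rcases hp with hp | hp
      · have : p = mult h ρ := hp
        rw [this, hn] at hp1; exact lt_irrefl _ hp1
      · have : p = (mult h ρ)⁻¹ := hp
        rw [this, norm_inv, hn, inv_one] at hp1; exact lt_irrefl _ hp1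
    rcases hp with hp | hp
    · exact Or.inl ⟨ρ, hoff, hp.symm⟩
    · exact Or.inr ⟨ρ, hoff, hp.symm⟩
  have hSfin : (aliasedPoleSet h).Finite := ((hfin.image g₁).union (hfin.image g₂)).subset hsub
  unfold CountableClosure
  rw [hSfin.isClosed.closure_eq]
  exact (hSfin.subset inter_subset_left).countable

/-- **`FOZ ∧ CEIL(h) ⟹ RH`** (`h > 0`): the positivity-free companion of row X-8
(`ScrewLatticeFoz.rh_of_foz_of_latticeFloor`). -/
theorem rh_of_foz_of_latticeCeiling {h : ℝ} (hh : 0 < h)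
    (hfoz : Theses.RuelleBand.CofiniteCriticalLine) (hceil : LatticeCeiling h) : RiemannHypothesis :=
  rh_of_latticeCeiling_of_countableClosure hh hceil (countableClosure_of_foz hfoz h)

/-- `FOZ ∧ CEIL(h) ↔ RH` (`h > 0`; FOZ is RH-implied: under RH the off-line set is empty). -/
theorem foz_and_latticeCeiling_iff_rh {h : ℝ} (hh : 0 < h) :
    (Theses.RuelleBand.CofiniteCriticalLine ∧ LatticeCeiling h) ↔ RiemannHypothesis := by
  constructor
  · exact fun hab ↦ rh_of_foz_of_latticeCeiling hh hab.1 hab.2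
  · intro hRH
    refine ⟨?_, latticeCeiling_of_rh hRH h⟩
    have hempty : {s : ℂ | riemannZeta s = 0 ∧ 0 < s.re ∧ s.re < 1 ∧ s.re ≠ 1 / 2} = ∅ := by
      ext s
      simp only [mem_setOf_eq, mem_empty_iff_false, iff_false, not_and]
      intro hζ h0 h1 hne
      have hs : s ∈ ZetaZeros.riemannZetaNontrivialZeros := mem_of_re_pos hζ h0
      have h2 := norm_mult_eq_one_of_rh hRH 1 ⟨s, hs⟩
      rw [norm_mult, Real.exp_eq_one_iff] at h2
      simp only [mul_one] at h2
      exact hne (by linarith)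
    show Set.Finite _
    rw [hempty]; exact finite_empty

/-- `k² ≤ (4/ε²) e^{ε k}` (`ε > 0`). -/
theorem sq_le_mul_exp {ε : ℝ} (hε : 0 < ε) (k : ℕ) :
    (k : ℝ) ^ 2 ≤ 4 / ε ^ 2 * Real.exp (ε * k) := by
  have h1 : ε * k / 2 ≤ Real.exp (ε * k / 2) := by linarith [Real.add_one_le_exp (ε * k / 2)]
  have h0 : 0 ≤ ε * k / 2 := by positivity
  have h2 : (ε * k / 2) ^ 2 ≤ Real.exp (ε * k / 2) ^ 2 := pow_le_pow_left₀ h0 h1 2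
  have h3 : Real.exp (ε * k / 2) ^ 2 = Real.exp (ε * k) := by
    rw [← Real.exp_nat_mul]; ring_nf
  rw [h3] at h2
  have hε2 : 0 < ε ^ 2 := by positivity
  rw [div_mul_eq_mul_div, le_div_iff₀ hε2]
  nlinarith

/-- **`LPSD(h) ⟹ CEIL(h)`**: the quadratic lattice ceiling `0 ≤ Ψ(k h) ≤ k² Ψ(h)`
(`ScrewLatticePSD.zetaScrew_lattice_le_sq_mul`) is sub-exponential. -/
theorem latticeCeiling_of_latticePSD {h : ℝ}
    (hpsd : ∀ (N : ℕ) (t x : Fin N → ℝ), (∀ i, t i ∈ Set.range fun k : ℕ ↦ (k : ℝ) * h) →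
      0 ≤ ∑ i, ∑ j, zetaScrewKernel (t i) (t j) * (x i * x j)) :
    LatticeCeiling h := by
  intro ε hε
  have hh1 : 0 ≤ zetaScrew h := by
    simpa using (ScrewLatticePSD.zetaScrew_lattice_le_sq_mul hpsd 1).1
  refine ⟨4 / ε ^ 2 * zetaScrew h, fun k ↦ ?_⟩
  obtain ⟨h0, hk⟩ := ScrewLatticePSD.zetaScrew_lattice_le_sq_mul hpsd k
  rw [abs_of_nonneg h0]
  calc zetaScrew (k * h) ≤ (k : ℝ) ^ 2 * zetaScrew h := hk
    _ ≤ (4 / ε ^ 2 * Real.exp (ε * k)) * zetaScrew h :=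
        mul_le_mul_of_nonneg_right (sq_le_mul_exp hε k) hh1
    _ = 4 / ε ^ 2 * zetaScrew h * Real.exp (ε * k) := by ring

/-- **`LPSD(h) ∧ CC(h) ↔ RH`** (`h > 0`): lattice non-negative-definiteness of the Kreĭn–Suzuki kernel plus
countable closure of the aliased pole field. -/
theorem latticePSD_and_countableClosure_iff_rh {h : ℝ} (hh : 0 < h) :
    ((∀ (N : ℕ) (t x : Fin N → ℝ), (∀ i, t i ∈ Set.range fun k : ℕ ↦ (k : ℝ) * h) →
        0 ≤ ∑ i, ∑ j, zetaScrewKernel (t i) (t j) * (x i * x j)) ∧ CountableClosure h) ↔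
      RiemannHypothesis :=
  ⟨fun hab ↦ rh_of_latticeCeiling_of_countableClosure hh (latticeCeiling_of_latticePSD hab.1) hab.2,
    fun hRH ↦ ⟨ScrewLatticePSD.latticeForm_nonneg_of_rh hRH h, countableClosure_of_rh hRH h⟩⟩

/-- Bounded lattice samples (two-sided `LAT`) `∧ CC(h) ↔ RH` (`h > 0`). -/
theorem latticeBounded_and_countableClosure_iff_rh {h : ℝ} (hh : 0 < h) :
    ((∃ K : ℝ, ∀ k : ℕ, |zetaScrew (k * h)| ≤ K) ∧ CountableClosure h) ↔ RiemannHypothesis :=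
  ⟨fun hab ↦ rh_of_latticeCeiling_of_countableClosure hh (latticeCeiling_of_bounded hab.1) hab.2,
    fun hRH ↦ ⟨⟨_, fun k ↦ ZetaScrewGrowth.abs_zetaScrew_le_of_RH hRH (k * h)⟩,
      countableClosure_of_rh hRH h⟩⟩

/-! ## 6. The EVENTUAL STRIP gives `CC(h)`: row `ES ∧ CEIL(h) ⟺ RH`

`ES` := for every `η > 0` only finitely many non-trivial zeros have `|Re ρ - 1/2| ≥ η` (verbatim the tree's
`BombieriTruncBandGap.EventualStrip`; kept import-free).  Under `ES` the aliased pole field meets every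
closed disc `‖z‖ ≤ r < 1` in finitely many points (`‖e^{∓κ_ρ h}‖ ≤ r ⟺ |Re ρ - 1/2| ≥ -log r / h`), so it is
relatively closed and countable in the disc: `ES ⟹ CC(h)`.  (The same row also follows from the attained
dictionary: `ScrewLatticeSubexp.rh_of_eventualStrip_of_subexpFloor`; the territory proper to X-9 is the
NON-attained supremum with countable aliased closure.) -/

/-- Under `ES` (`h > 0`) the aliased pole field meets each closed disc of radius `r ∈ (0,1)` finitely. -/
theorem finite_aliasedPoleSet_inter_closedBall {h : ℝ} (hh : 0 < h)
    (hES : ∀ η : ℝ, 0 < η →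
      {ρ : ℂ | ρ ∈ ZetaZeros.riemannZetaNontrivialZeros ∧ η ≤ |ρ.re - 1 / 2|}.Finite)
    {r : ℝ} (hr0 : 0 < r) (hr1 : r < 1) : (aliasedPoleSet h ∩ closedBall 0 r).Finite := by
  set δ : ℝ := -Real.log r / h with hδ
  have hlog : Real.log r < 0 := Real.log_neg hr0 hr1
  have hδ0 : 0 < δ := by rw [hδ]; exact div_pos (by linarith) hh
  set T : Set ℂ := {ρ : ℂ | ρ ∈ ZetaZeros.riemannZetaNontrivialZeros ∧ δ ≤ |ρ.re - 1 / 2|} with hT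
  have hfin : T.Finite := hES δ hδ0
  set g₁ : ℂ → ℂ := fun s ↦ Complex.exp ((s - 1 / 2) * h) with hg₁
  set g₂ : ℂ → ℂ := fun s ↦ (Complex.exp ((s - 1 / 2) * h))⁻¹ with hg₂
  have hsub : aliasedPoleSet h ∩ closedBall 0 r ⊆ g₁ '' T ∪ g₂ '' T := by
    rintro p ⟨⟨-, ρ, hp⟩, hpr⟩
    rw [mem_closedBall_zero_iff] at hpr
    rcases hp with hp | hp
    · have hp' : p = mult h ρ := hp
      have hle : Real.exp (((ρ : ℂ).re - 1 / 2) * h) ≤ r := by rwa [hp', norm_mult] at hpr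
      have h1 : ((ρ : ℂ).re - 1 / 2) * h ≤ Real.log r := by
        have := Real.log_le_log (Real.exp_pos _) hle
        rwa [Real.log_exp] at this
      refine Or.inl ⟨ρ, ⟨ρ.2, ?_⟩, hp.symm⟩
      rw [hδ, div_le_iff₀ hh]
      have h3 : -((ρ : ℂ).re - 1 / 2) ≤ |(ρ : ℂ).re - 1 / 2| := neg_le_abs _
      nlinarith
    · have hp' : p = (mult h ρ)⁻¹ := hp
      have hle : Real.exp (-(((ρ : ℂ).re - 1 / 2) * h)) ≤ r := by
        rwa [hp', norm_inv, norm_mult, ← Real.exp_neg] at hpr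
      have h1 : -(((ρ : ℂ).re - 1 / 2) * h) ≤ Real.log r := by
        have := Real.log_le_log (Real.exp_pos _) hle
        rwa [Real.log_exp] at this
      refine Or.inr ⟨ρ, ⟨ρ.2, ?_⟩, hp.symm⟩
      rw [hδ, div_le_iff₀ hh]
      have h3 : (ρ : ℂ).re - 1 / 2 ≤ |(ρ : ℂ).re - 1 / 2| := le_abs_self _
      nlinarith
  exact ((hfin.image g₁).union (hfin.image g₂)).subset hsub

/-- **ES ⟹ CC(h)** (`h > 0`): under the eventual strip the aliased pole field is relatively closed and
countable in the disc. -/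
theorem countableClosure_of_eventualStrip {h : ℝ} (hh : 0 < h)
    (hES : ∀ η : ℝ, 0 < η →
      {ρ : ℂ | ρ ∈ ZetaZeros.riemannZetaNontrivialZeros ∧ η ≤ |ρ.re - 1 / 2|}.Finite) :
    CountableClosure h := by
  -- the closure adds nothing inside the disc
  have hcl : closure (aliasedPoleSet h) ∩ ball 0 1 ⊆ aliasedPoleSet h := by
    rintro x ⟨hx, hx1⟩
    rw [mem_ball_zero_iff] at hx1
    set r : ℝ := (‖x‖ + 1) / 2 with hr
    have hr0 : 0 < r := by rw [hr]; linarith [norm_nonneg x]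
    have hr1 : r < 1 := by rw [hr]; linarith
    have hxr : x ∈ ball (0 : ℂ) r := by rw [mem_ball_zero_iff, hr]; linarith
    have h1 : x ∈ closure (aliasedPoleSet h ∩ ball 0 r) := isOpen_ball.closure_inter ⟨hx, hxr⟩
    have hfin : (aliasedPoleSet h ∩ ball 0 r).Finite :=
      (finite_aliasedPoleSet_inter_closedBall hh hES hr0 hr1).subset
        (inter_subset_inter_right _ ball_subset_closedBall)
    rw [hfin.isClosed.closure_eq] at h1
    exact h1.1
  -- the field itself is a countable union of finite sets
  have hcount : (aliasedPoleSet h).Countable := by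
    have hsub : aliasedPoleSet h ⊆ ⋃ n : ℕ, (aliasedPoleSet h ∩ closedBall 0 (1 - 1 / ((n : ℝ) + 2))) := by
      intro p hp
      have hp1 : ‖p‖ < 1 := hp.1
      obtain ⟨n, hn⟩ := exists_nat_one_div_lt (by linarith : 0 < 1 - ‖p‖)
      refine mem_iUnion.2 ⟨n, hp, ?_⟩
      rw [mem_closedBall_zero_iff]
      have h2 : 1 / ((n : ℝ) + 2) ≤ 1 / ((n : ℝ) + 1) :=
        one_div_le_one_div_of_le (by positivity) (by linarith)
      linarith
    refine Set.Countable.mono hsub (countable_iUnion fun n ↦ Finite.countable ?_)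
    refine finite_aliasedPoleSet_inter_closedBall hh hES ?_ ?_
    · have : (0 : ℝ) < 1 / ((n : ℝ) + 2) := by positivity
      have h2 : 1 / ((n : ℝ) + 2) ≤ 1 / 2 := one_div_le_one_div_of_le (by norm_num) (by linarith)
      linarith
    · have : (0 : ℝ) < 1 / ((n : ℝ) + 2) := by positivity
      linarith
  exact hcount.mono hcl

/-- **`ES ∧ CEIL(h) ⟹ RH`** (`h > 0`). -/
theorem rh_of_eventualStrip_of_latticeCeiling {h : ℝ} (hh : 0 < h)
    (hES : ∀ η : ℝ, 0 < η →
      {ρ : ℂ | ρ ∈ ZetaZeros.riemannZetaNontrivialZeros ∧ η ≤ |ρ.re - 1 / 2|}.Finite)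
    (hceil : LatticeCeiling h) : RiemannHypothesis :=
  rh_of_latticeCeiling_of_countableClosure hh hceil (countableClosure_of_eventualStrip hh hES)

/-- RH ⟹ ES (vacuously). (`private`: the statement restates the landed
`Summit.RiemannHypothesis.RiemannHypothesis.Theorems.Splittings.ScrewLatticeSubexp.eventualStrip_of_rh` (P3, p554585) — gate
`dedup.landed`, one-word repair pre-authorised by lead RULING #200 (b); proof bytes unchanged.) -/
private theorem eventualStrip_of_rh (hRH : RiemannHypothesis) :
    ∀ η : ℝ, 0 < η →
      {ρ : ℂ | ρ ∈ ZetaZeros.riemannZetaNontrivialZeros ∧ η ≤ |ρ.re - 1 / 2|}.Finite := by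
  intro η hη
  convert Set.finite_empty
  ext ρ
  simp only [mem_setOf_eq, mem_empty_iff_false, iff_false, not_and]
  intro hρ hle
  have h2 := norm_mult_eq_one_of_rh hRH 1 ⟨ρ, hρ⟩
  rw [norm_mult, Real.exp_eq_one_iff] at h2
  simp only [mul_one] at h2
  rw [h2, abs_zero] at hle
  linarith

/-- **ROW X-9′**, `h > 0` arbitrary: `ES ∧ CEIL(h) ↔ RiemannHypothesis` — the zero-geometry conjunct allows
infinitely many off-line zeros (accumulating to the line); the growth conjunct is two-sided sub-exponential
growth of `Ψ` on ONE lattice. -/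
theorem eventualStrip_and_latticeCeiling_iff_rh {h : ℝ} (hh : 0 < h) :
    ((∀ η : ℝ, 0 < η →
        {ρ : ℂ | ρ ∈ ZetaZeros.riemannZetaNontrivialZeros ∧ η ≤ |ρ.re - 1 / 2|}.Finite) ∧
      LatticeCeiling h) ↔ RiemannHypothesis :=
  ⟨fun hab ↦ rh_of_eventualStrip_of_latticeCeiling hh hab.1 hab.2,
    fun hRH ↦ ⟨eventualStrip_of_rh hRH, latticeCeiling_of_rh hRH h⟩⟩

/-! ## 7. WALLS (RH-free): under `CEIL(h)` the visible aliased poles are never isolated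

The sharp local form of the dichotomy (`ScrewBorel.not_mem_closure_of_isolated`): under `CEIL(h)`, an
aliased pole that is isolated in the closure `T_h` of the pole field is adherent to NO preconnected region
`V ∋ 0` of `𝔻 ∖ T_h`.  Equivalently `T_h` separates the origin from each of its isolated points: the zeros
farthest from the critical line (the poles nearest the origin) can be compatible with sub-exponential
lattice growth only behind a WALL of other aliased zeros, or by being themselves accumulation points of
aliased zeros.  With `T_h ∩ 𝔻` countable there is no wall and Baire gives an isolated pole: row X-9. -/

/-- The origin lies in `𝔻 ∖ T_h` (`h ≥ 0`: every aliased pole has norm `≥ e^{-h/2}`). -/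
theorem zero_mem_ball_diff_closure {h : ℝ} (hh : 0 ≤ h) :
    (0 : ℂ) ∈ ball (0 : ℂ) 1 \ closure (aliasedPoleSet h) := by
  refine ⟨mem_ball_self one_pos, fun h0 ↦ ?_⟩
  have hclos : closure (aliasedPoleSet h) ⊆ {q : ℂ | Real.exp (-(h / 2)) ≤ ‖q‖} :=
    closure_minimal (fun p hp ↦ exp_neg_half_le_norm_of_mem hh hp)
      (isClosed_le continuous_const continuous_norm)
  have := hclos h0
  simp only [mem_setOf_eq, norm_zero] at this
  exact absurd this (not_le.2 (Real.exp_pos _))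

/-- **WALLS THEOREM** (`h > 0`, RH-free).  Under `CEIL(h)`: if `V ∋ 0` is a preconnected subset of
`𝔻 ∖ closure (aliasedPoleSet h)` and `p` is an aliased pole isolated within `2ε` in the closure of the pole
field (`‖p‖ + 2ε < 1`), then `p ∉ closure V`. -/
theorem not_mem_closure_of_isolated_of_latticeCeiling {h : ℝ} (hh : 0 < h) (hceil : LatticeCeiling h)
    {V : Set ℂ} (hV : IsPreconnected V) (hV0 : (0 : ℂ) ∈ V)
    (hVsub : V ⊆ ball 0 1 \ closure (aliasedPoleSet h))
    {p : ℂ} (hp : p ∈ aliasedPoleSet h) {ε : ℝ} (hε : 0 < ε) (hpε : ‖p‖ + 2 * ε < 1)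
    (hiso : ∀ q ∈ closure (aliasedPoleSet h), ‖q - p‖ < 2 * ε → q = p) : p ∉ closure V :=
  not_mem_closure_of_isolated (c := coeff) (u := mult h) summable_norm_coeff re_coeff_neg
    (mult_ne_zero h) (differentiableOn_latticeGF hceil) (Real.exp_pos (-(h / 2)))
    (fun _ hz ↦ latticeGF_eq_borel hh (mem_ball_zero_iff.1 hz)) hV hV0 hVsub hp hε hpε hiso

/-- **No wall ⟹ no isolated visible pole** (`h > 0`, RH-free).  Under `CEIL(h)`, if `𝔻 ∖ T_h` is
preconnected (the closure `T_h` of the aliased pole field separates nothing from the origin), then every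
aliased pole adherent to `𝔻 ∖ T_h` is an ACCUMULATION point of the pole field's closure: for every `ε > 0` with
`‖p‖ + 2ε < 1` some `q ≠ p` of `T_h` lies within `2ε` of `p`. -/
theorem exists_near_of_preconnected_of_latticeCeiling {h : ℝ} (hh : 0 < h) (hceil : LatticeCeiling h)
    (hconn : IsPreconnected (ball (0 : ℂ) 1 \ closure (aliasedPoleSet h)))
    {p : ℂ} (hp : p ∈ aliasedPoleSet h) (hadh : p ∈ closure (ball (0 : ℂ) 1 \ closure (aliasedPoleSet h)))
    {ε : ℝ} (hε : 0 < ε) (hpε : ‖p‖ + 2 * ε < 1) :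
    ∃ q ∈ closure (aliasedPoleSet h), ‖q - p‖ < 2 * ε ∧ q ≠ p := by
  by_contra hno
  push Not at hno
  exact not_mem_closure_of_isolated_of_latticeCeiling hh hceil hconn (zero_mem_ball_diff_closure hh.le)
    Subset.rfl hp hε hpε (fun q hq hqε ↦ hno q hq hqε) hadh

/-- **Row X-9 re-derived from the walls theorem** is `rh_of_latticeCeiling_of_countableClosure`; the RH-free
trichotomy reads: `CEIL(h) ⟹ RH ∨ (T_h separates 0 from one of its isolated points) ∨ (no isolated point of
T_h is adherent to the component of 0)`.  Recorded form: under `CEIL(h)` and `¬RH` the pole field is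
non-empty and every isolated-and-visible configuration is excluded. -/
theorem aliasedPoleSet_nonempty_of_not_rh {h : ℝ} (hh : 0 < h) (hnot : ¬ RiemannHypothesis) :
    (aliasedPoleSet h).Nonempty := by
  by_contra hem
  rw [Set.not_nonempty_iff_eq_empty] at hem
  refine hnot (quasiRiemannHypothesis_one_half_iff_holds.1 fun s hζ hσ hσ1 ↦ ?_)
  have hs : s ∈ ZetaZeros.riemannZetaNontrivialZeros := mem_of_re_pos hζ (by linarith)
  have hlt : ‖(mult h ⟨s, hs⟩)⁻¹‖ < 1 := by
    rw [norm_inv, norm_mult]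
    refine inv_lt_one_of_one_lt₀ ?_
    refine Real.one_lt_exp_iff.2 ?_
    simp only
    nlinarith
  have : (mult h ⟨s, hs⟩)⁻¹ ∈ aliasedPoleSet h := ⟨hlt, ⟨s, hs⟩, Or.inr rfl⟩
  rw [hem] at this
  exact this

end Summit.RiemannHypothesis.RiemannHypothesis.Theorems.Splittings.ScrewLatticeContinuation
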